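import Mathlib
import Literature.Analysis.FluidPDE.SelfSimilarEulerProfile
import Literature.Analysis.FluidPDE.SwirlTransportProofs
import Literature.Analysis.FluidPDE.VorticityStretching
import Literature.Analysis.FunctionSpaces.SobolevDomain
import Summits.NavierStokesRegularity.NavierStokesRegularity.Theorems.EulerZoomLiouvillePowerGaugeEulerLiouvilleWeakAxisymAzimuthal
import Summits.NavierStokesRegularity.NavierStokesRegularity.Theorems.EulerZoomLiouvillePowerGaugeEulerLiouvilleWeakAxisymCasimirOffAxisTools

/-!
# Crux `EulerZoomLiouville.PowerGaugeEulerLiouville` (stmt-NavierStokesRegularity-19832), weak stratum, line `weak_axisym` (ns-idea-11 g9):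
# X1a, PART (B1) — THE DAMPED CASIMIR LAW OFF THE AXIS

Width seat ns-ezl-w2 g6 under the LEAD ns-typeII-p2 g15.  First-order weak calculus, no class, no Euler beyond the weak vorticity equation.
Data: `V, η ∈ L²_loc(ℝ³)`, `G ∈ L²_loc` (the DiPerna–Lions gradient), `W = γy + V` (`selfSimilarTransport γ 0 V`), `k×y = (−y₁,y₀,0)` (`rotGen`),
(1) `G(y)(k×y) = k×V(y)` a.e., (Ω) `curlCLM (G y) = η(y)·(k×y)` a.e. (azimuthal vorticity, part (A)), and THE WEAK VORTICITY EQUATION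
`∫ ⟪Ω, e⟫ Dφ[W] = ∫ φ ⟪(1−3γ)Ω − GΩ, e⟫` for all tests `φ` and `e ∈ ℝ³`.
Conclusion (`thetaTransport_of_offAxis`): for every test `ψ` supported OFF the axis (`δ ≤ y₀²+y₁²` on `tsupport ψ`),
`∫ η Dψ[W] = (1 − 2γ) ∫ η ψ` — the damped Casimir law `div(Wη) = (2γ−1)η` tested off the axis.

Proof.  Test the vorticity equation with `φᵢ = ψ·(k×y)ᵢ/ϱ²` (smooth: `ψ` vanishes near the axis), `e = eᵢ`, and sum over `i`:
`Σᵢ Ωᵢ Dφᵢ[W] = η Dψ[W] − ψη⟪y_h, W⟫/ϱ²` and `Σᵢ φᵢ⟪(1−3γ)Ω − GΩ, eᵢ⟫ = ψ((1−3γ)η − η⟪y_h, V⟫/ϱ²)` a.e. (`GΩ = ηG(k×y) = η k×V`);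
with `⟪y_h, W⟫ = γϱ² + ⟪y_h, V⟫` the `V`-terms CANCEL: `∫ηDψ[W] − γ∫ψη = (1−3γ)∫ψη`.

WHAT THIS IS NOT: not NS, not E, not X1a itself (the axis removal `SolvesThetaTransport` for all tests is the sequel (B2)) — 19832 is OPEN. [folklore]
-/

noncomputable section

set_option linter.dupNamespace false

open MeasureTheory Set Filter Topology Function TopologicalSpace Metric
open scoped ENNReal NNReal RealInnerProductSpace ContDiff

namespace Summit.NavierStokesRegularity.NavierStokesRegularity.Theorems.PowerGaugeEulerLiouville.WeakAxisym

open Literature.Analysis.FunctionSpaces Literature.Analysis.FluidPDE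

/-! ### The damped Casimir law off the axis -/

section Law

variable {γ : ℝ} {V : EuclideanSpace ℝ (Fin 3) → EuclideanSpace ℝ (Fin 3)}
  {G : EuclideanSpace ℝ (Fin 3) → EuclideanSpace ℝ (Fin 3) →L[ℝ] EuclideanSpace ℝ (Fin 3)} {η : EuclideanSpace ℝ (Fin 3) → ℝ}

/-- **X1a (B1): THE DAMPED CASIMIR LAW OFF THE AXIS.**  Let `V, η ∈ L²_loc(ℝ³)`, `G ∈ L²_loc`, `W = γ(y−0) + V`
(`selfSimilarTransport γ 0 V`), with (1) `G(y)(k×y) = k×V(y)` a.e., (Ω) `curlCLM (G y) = η(y)·(k×y)` a.e., and the weak vorticity equation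
`∫ ⟪curlCLM (G y), e⟫ Dφ[W] = ∫ φ ⟪(1−3γ)curlCLM (G y) − G y (curlCLM (G y)), e⟫` for all tests `φ` and all `e`.  Then for every test `ψ`
whose support keeps a distance from the axis (`δ ≤ y₀²+y₁²` on `tsupport ψ`, `δ > 0`):
`∫ η Dψ[W] = (1 − 2γ) ∫ η ψ`. [folklore] -/
theorem thetaTransport_of_offAxis
    (hV2 : ∀ r : ℝ, MemLp V 2 (volume.restrict (ball (0 : EuclideanSpace ℝ (Fin 3)) r)))
    (hG2 : ∀ r : ℝ, MemLp G 2 (volume.restrict (ball (0 : EuclideanSpace ℝ (Fin 3)) r)))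
    (hη2 : ∀ r : ℝ, MemLp η 2 (volume.restrict (ball (0 : EuclideanSpace ℝ (Fin 3)) r)))
    (h1 : ∀ᵐ y ∂(volume : Measure (EuclideanSpace ℝ (Fin 3))),
      G y (WithLp.toLp 2 ![-(y 1), y 0, 0]) = WithLp.toLp 2 ![-(V y 1), V y 0, 0])
    (hΩ : ∀ᵐ y ∂(volume : Measure (EuclideanSpace ℝ (Fin 3))), curlCLM (G y) = η y • WithLp.toLp 2 ![-(y 1), y 0, 0])
    (hvort : ∀ φ : EuclideanSpace ℝ (Fin 3) → ℝ, IsTestFunctionOn (⊤ : Opens (EuclideanSpace ℝ (Fin 3))) φ →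
      ∀ e : EuclideanSpace ℝ (Fin 3),
        ∫ y, ⟪curlCLM (G y), e⟫ * fderiv ℝ φ y (selfSimilarTransport γ 0 V y) =
          ∫ y, φ y * ⟪(1 - 3 * γ) • curlCLM (G y) - G y (curlCLM (G y)), e⟫)
    {ψ : EuclideanSpace ℝ (Fin 3) → ℝ} (hψ : IsTestFunctionOn (⊤ : Opens (EuclideanSpace ℝ (Fin 3))) ψ) {δ : ℝ} (hδ : 0 < δ)
    (hoff : ∀ y ∈ tsupport ψ, δ ≤ y 0 ^ 2 + y 1 ^ 2) :
    ∫ y, η y * fderiv ℝ ψ y (selfSimilarTransport γ 0 V y) = (1 - 2 * γ) * ∫ y, η y * ψ y := by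
  set W : EuclideanSpace ℝ (Fin 3) → EuclideanSpace ℝ (Fin 3) := selfSimilarTransport γ 0 V with hW
  have hW2 : ∀ r : ℝ, MemLp W 2 (volume.restrict (ball (0 : EuclideanSpace ℝ (Fin 3)) r)) :=
    memLp_selfSimilarTransport_ball hV2 γ
  -- ### the three tested equations, summed
  set φ : Fin 3 → EuclideanSpace ℝ (Fin 3) → ℝ := fun i y => ψ y * ((y 0 ^ 2 + y 1 ^ 2)⁻¹ * rotGen y i) with hφ
  have hφt : ∀ i, IsTestFunctionOn (⊤ : Opens (EuclideanSpace ℝ (Fin 3))) (φ i) := fun i =>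
    isTestFunctionOn_azimuthalTest hψ hδ hoff i
  have hE : ∀ i : Fin 3, ∫ y, ⟪curlCLM (G y), EuclideanSpace.single i (1 : ℝ)⟫ * fderiv ℝ (φ i) y (W y) =
      ∫ y, φ i y * ⟪(1 - 3 * γ) • curlCLM (G y) - G y (curlCLM (G y)), EuclideanSpace.single i (1 : ℝ)⟫ :=
    fun i => hvort (φ i) (hφt i) _
  have hsum : ∫ y, ∑ i : Fin 3, ⟪curlCLM (G y), EuclideanSpace.single i (1 : ℝ)⟫ * fderiv ℝ (φ i) y (W y) =
      ∫ y, ∑ i : Fin 3, φ i y * ⟪(1 - 3 * γ) • curlCLM (G y) - G y (curlCLM (G y)), EuclideanSpace.single i (1 : ℝ)⟫ := by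
    rw [integral_finsetSum _ fun i _ => integrable_vort_mul_fderiv_test hG2 hW2 (hφt i) _,
      integral_finsetSum _ fun i _ => integrable_test_mul_source hG2 (hφt i) γ _]
    exact Finset.sum_congr rfl fun i _ => hE i
  -- ### pointwise a.e. identification of both sums (off the null axis)
  have hq : ∀ᵐ y ∂(volume : Measure (EuclideanSpace ℝ (Fin 3))), y 0 ^ 2 + y 1 ^ 2 ≠ 0 := by
    filter_upwards [ae_coord_zero_ne_zero] with y hy
    positivity
  have hψd : ∀ y, DifferentiableAt ℝ ψ y := fun y => (hψ.contDiff.differentiable (by simp)).differentiableAt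
  have hL : (fun y => ∑ i : Fin 3, ⟪curlCLM (G y), EuclideanSpace.single i (1 : ℝ)⟫ * fderiv ℝ (φ i) y (W y)) =ᵐ[volume]
      fun y => η y * fderiv ℝ ψ y (W y) - γ * (η y * ψ y) -
        ψ y * η y * ((y 0 * V y 0 + y 1 * V y 1) / (y 0 ^ 2 + y 1 ^ 2)) := by
    filter_upwards [hq, hΩ] with y hqy hΩy
    rw [sum_vort_mul_fderiv_azimuthalTest (hψd y) hqy hΩy (W y)]
    have hW0 : W y 0 = γ * y 0 + V y 0 := by
      simp only [hW, selfSimilarTransport_apply, sub_zero, PiLp.add_apply, PiLp.smul_apply, smul_eq_mul]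
    have hW1 : W y 1 = γ * y 1 + V y 1 := by
      simp only [hW, selfSimilarTransport_apply, sub_zero, PiLp.add_apply, PiLp.smul_apply, smul_eq_mul]
    rw [hW0, hW1]
    field_simp
    ring
  have hRt : (fun y => ∑ i : Fin 3, φ i y * ⟪(1 - 3 * γ) • curlCLM (G y) - G y (curlCLM (G y)), EuclideanSpace.single i (1 : ℝ)⟫)
      =ᵐ[volume] fun y => (1 - 3 * γ) * (η y * ψ y) - ψ y * η y * ((y 0 * V y 0 + y 1 * V y 1) / (y 0 ^ 2 + y 1 ^ 2)) := by
    filter_upwards [hq, hΩ, h1] with y hqy hΩy h1y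
    rw [sum_azimuthalTest_mul_source hqy hΩy h1y]
    ring
  rw [integral_congr_ae hL, integral_congr_ae hRt] at hsum
  -- ### split the integrals: the `V`-terms cancel
  have I3 : Integrable (fun y => η y * fderiv ℝ ψ y (W y)) volume := integrable_eta_mul_fderiv_test hη2 hW2 hψ
  have I4 : Integrable (fun y => η y * ψ y) volume := integrable_eta_mul_test hη2 hψ
  have I5 := integrable_test_mul_eta_mul_radial hη2 hV2 hψ hδ hoff
  have I4γ : Integrable (fun y => γ * (η y * ψ y)) volume := I4.const_mul γ
  have I4γ' : Integrable (fun y => (1 - 3 * γ) * (η y * ψ y)) volume := I4.const_mul _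
  have I34 : Integrable (fun y => η y * fderiv ℝ ψ y (W y) - γ * (η y * ψ y)) volume := I3.sub I4γ
  rw [integral_sub I34 I5, integral_sub I3 I4γ, integral_sub I4γ' I5, integral_const_mul, integral_const_mul] at hsum
  linarith

end Law

end Summit.NavierStokesRegularity.NavierStokesRegularity.Theorems.PowerGaugeEulerLiouville.WeakAxisym

end
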